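import Literature.AnabelianGeometry.AbsoluteAnabelian.AbsTopIII.KummerCurveLaws
import HarnessLib

/-!
# Non-vacuity records (DEGENERATE) for the [AbsTopIII] §1 Kummer interfaces
# `IntrinsicKummerModel` and `NaturalKummerModel`

Mochizuki, *Topics in Absolute Anabelian Geometry III*, §1, Prop. 1.4 p. 31 ("`U ⊆ X` a nonempty open
subscheme"), Prop. 1.6 p. 34 ("the associated Kummer map"), lit key `paper:url-5493eb38cbb7`.
Cell abc-iut, layer L4, INTERFACE-NV-CENSUS (abc-iut-w5-d243) rows `IntrinsicKummerModel`
(abc-iut-L4-t1, `KummerIntrinsic.lean`) and its successor structure `NaturalKummerModel`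
(abc-iut-L4-t1, `KummerCurveLaws.lean`, 41 per-curve law fields), over which the [AbsTopIII] Thm. 1.9
sub-DAG closers are stated (`NaturalKummerModel.thm19c`, `IntrinsicKummerModel.thm19d_inj_of_naturality`,
…).  This PROOF-ONLY file records, in the same honesty class as `AbsTopIII.CurveModel.nonempty_degenerate`
(`FundamentalExtensionNonVacuity.lean`):

* `IntrinsicKummerModel.exists_isEmpty_curve` / `nonempty_degenerate` — the interface is inhabited by the
  model with NO curves (empty index type; every curve-indexed datum is `PEmpty.elim`);
* `NaturalKummerModel.nonempty_degenerate` — so is the successor structure: every one of its 41 fields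
  except the sign datum `degSign : ℤˣ` is curve-indexed, hence NO law field is a closed contradiction and
  the law bundle is jointly satisfiable at the tautological level;
* `NaturalKummerModel.degSign_eq_one_or` — the only curve-free datum takes one of two values.

HONEST LIMITS: a DEGENERATE witness.  It certifies only that no theorem quantified over these
interfaces is vacuous for want of ANY instance; it says nothing about satisfiability of the laws at the
intended étale-`π₁` model of hyperbolic curves (campaign L), which is what the laws are ABOUT (typing
policy θ of the interface owner).  Nothing here bears on [IUTchIII] Cor. 3.12; no definition, no named
fact, no instance.
-/

namespace Literature.AnabelianGeometry.AbsoluteAnabelian.AbsTopIII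

universe u

/-- **`IntrinsicKummerModel` has an inhabitant with an EMPTY index of curves** (DEGENERATE: all
curve-indexed data are `PEmpty.elim`). [cite: MochizukiAbsTopIII2015, Prop 1.6 p.34] -/
theorem IntrinsicKummerModel.exists_isEmpty_curve :
    ∃ I : IntrinsicKummerModel.{u}, IsEmpty I.Curve :=
  ⟨{ Curve := PEmpty.{u + 2}
     base := fun U => U.elim
     instField := fun U => U.elim
     instCharZero := fun U => U.elim
     ext := fun U => U.elim
     galIso := fun U => U.elim
     cusps := fun U => U.elim
     IsProper := fun U => U.elim
     IsScheme := fun U => U.elim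
     genus := fun U => U.elim
     FunctionField := fun U => U.elim
     instFunctionField := fun U => U.elim
     instAlgebra := fun U => U.elim
     Point := fun U => U.elim
     decomp := fun U => U.elim
     IsNFCurve := fun U => U.elim
     IsNFPoint := fun U => U.elim
     IsNFRational := fun U => U.elim
     IsNFConstant := fun U => U.elim
     NFFunctionField := fun U => U.elim
     instNFFunctionField := fun U => U.elim
     IsStrictlyBelyiType := fun U => U.elim
     IsCofiniteOpen := fun U => U.elim
     res := fun {U} => U.elim
     IsRationalPt := fun U => U.elim
     ptSection := fun {U} => U.elim
     ptSection_range := fun {U} => U.elim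
     ord := fun {U} => U.elim
     kummerMap := fun {U} => U.elim }, inferInstanceAs (IsEmpty PEmpty.{u + 2})⟩

/-- **`IntrinsicKummerModel` is inhabited (DEGENERATE no-curve model).**
[cite: MochizukiAbsTopIII2015, Prop 1.6 p.34] -/
theorem IntrinsicKummerModel.nonempty_degenerate : Nonempty IntrinsicKummerModel.{u} :=
  let ⟨I, _⟩ := IntrinsicKummerModel.exists_isEmpty_curve.{u}
  ⟨I⟩

/-- **`NaturalKummerModel` is inhabited (DEGENERATE no-curve model, `degSign := 1`)**: over the empty
index of curves every one of the 41 law/data fields of the successor structure other than `degSign` is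
vacuous, so the per-curve law bundle (cofinite opens, `K_U = K_X`, points, Kummer naturality, degree
law, separation, evaluation) contains NO closed contradiction. [cite: MochizukiAbsTopIII2015, Prop 1.6 p.34] -/
theorem NaturalKummerModel.nonempty_degenerate : Nonempty NaturalKummerModel.{u} := by
  obtain ⟨I, hI⟩ := IntrinsicKummerModel.exists_isEmpty_curve.{u}
  refine ⟨?_⟩
  fconstructor
  · exact I
  all_goals first | exact 1 | (intro U; exact isEmptyElim U)

/-- The only curve-free datum of `NaturalKummerModel` is the sign convention `degSign ∈ {±1}`.
[cite: MochizukiAbsTopIII2015, Prop 1.6 (iii) p.35] -/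
theorem NaturalKummerModel.degSign_eq_one_or (N : NaturalKummerModel.{u}) :
    N.degSign = 1 ∨ N.degSign = -1 :=
  Int.units_eq_one_or N.degSign

end Literature.AnabelianGeometry.AbsoluteAnabelian.AbsTopIII
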